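import Summits.AnomalousDissipation.AnomalousDissipation.Theorems.LimitingAbsorptionKinematicSteadySourceLawToolkit
import Literature.Analysis.FunctionSpaces.SpaceTimeWeakCompactness
import HarnessLib

/-!
# Route LimitingAbsorption (AnomalousDissipation) — `RelaxationBoundsInventory`, line `Sketch`,
stub `stub_eLpNormDecay` (crux stmt-AnomalousDissipation-2940)

Conversion of a relaxation bound from the `scalarL2Sq` currency (`scalarL2Sq f = ∫ f²`) to the
`eLpNorm` currency consumed by the Minkowski superposition lemma
`LapInventory.ae_eLpNorm_superposition_le`: for `f ∈ L²(T^d)`,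

  `scalarL2Sq f ≤ C e^{-γ t} scalarL2Sq h`, `C ≥ 0`  ⟹
  `‖f‖_{L²} ≤ √C · e^{-γ t / 2} · √(scalarL2Sq h)` (as an `ENNReal.ofReal` bound on `eLpNorm f 2`).

Proof: for `f ∈ L²`, `scalarL2Sq f = (∫⁻ ‖f‖ₑ²).toReal`
(`KinematicSteadySourceLaw.scalarL2Sq_eq_toReal_lintegral_and_lt_top`) and
`eLpNorm f 2 ^ 2 = ∫⁻ ‖f‖ₑ²` (`FunctionSpaces.eLpNorm_two_pow_two_eq_lintegral`), so
`(eLpNorm f 2).toReal ^ 2 = scalarL2Sq f`; the right-hand side `R = √C e^{-γt/2} √(scalarL2Sq h)`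
is nonnegative with `R ^ 2 = C e^{-γt} scalarL2Sq h`, and square roots are monotone.

Sources: folklore (`L²` bookkeeping; DEIJ 2022, (1.3) for the currency `‖θ‖²_{L²}`).
-/

noncomputable section

open MeasureTheory Set Filter Function TopologicalSpace Topology
open scoped ENNReal NNReal InnerProductSpace BigOperators

namespace Summit.AnomalousDissipation.AnomalousDissipation.Theorems.RelaxationBoundsInventory.ELpNormDecay

set_option linter.dupNamespace false

open Literature.Analysis Literature.Analysis.FluidPDE Literature.Analysis.FluidPDE.Torus

variable {d : Type*} [Fintype d]

/-- For `f ∈ L²(T^d)`, the real `L²` norm squared is the `scalarL2Sq` currency: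
`(eLpNorm f 2).toReal ^ 2 = scalarL2Sq f`. [folklore] -/
theorem toReal_eLpNorm_sq_eq_scalarL2Sq {f : UnitAddTorus d → ℝ} (hf : MemLp f 2 volume) :
    (eLpNorm f 2 volume).toReal ^ 2 = scalarL2Sq f := by
  rw [(KinematicSteadySourceLaw.scalarL2Sq_eq_toReal_lintegral_and_lt_top hf).1,
    ← ENNReal.toReal_pow, FunctionSpaces.eLpNorm_two_pow_two_eq_lintegral]

/-- **Relaxation bound in `eLpNorm` currency.** For `f ∈ L²(T^d)` the bound
`scalarL2Sq f ≤ C e^{-γ t} scalarL2Sq h` (`C ≥ 0`) reads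
`‖f‖_{L²} ≤ √C e^{-γt/2} √(scalarL2Sq h)` (`scalarL2Sq f = ‖f‖²_{L²}` for `f ∈ L²`,
`KinematicSteadySourceLaw.scalarL2Sq_eq_toReal_lintegral_and_lt_top`,
`FunctionSpaces.eLpNorm_two_pow_two_eq_lintegral`; square roots). [folklore] -/
theorem stub_eLpNormDecay {f h : UnitAddTorus d → ℝ} (hf : MemLp f 2 volume) {C γ t : ℝ}
    (hC : 0 ≤ C) (hle : scalarL2Sq f ≤ C * Real.exp (-(γ * t)) * scalarL2Sq h) :
    eLpNorm f 2 volume ≤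
      ENNReal.ofReal (Real.sqrt C * Real.exp (-(γ * t) / 2) * Real.sqrt (scalarL2Sq h)) := by
  set R : ℝ := Real.sqrt C * Real.exp (-(γ * t) / 2) * Real.sqrt (scalarL2Sq h) with hRdef
  have hR : 0 ≤ R :=
    mul_nonneg (mul_nonneg (Real.sqrt_nonneg _) (Real.exp_pos _).le) (Real.sqrt_nonneg _)
  have hR2 : R ^ 2 = C * Real.exp (-(γ * t)) * scalarL2Sq h := by
    rw [hRdef, mul_pow, mul_pow, Real.sq_sqrt hC, Real.sq_sqrt (scalarL2Sq_nonneg h), pow_two,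
      ← Real.exp_add, add_halves]
  rw [ENNReal.le_ofReal_iff_toReal_le hf.eLpNorm_ne_top hR]
  have hn : 0 ≤ (eLpNorm f 2 volume).toReal := ENNReal.toReal_nonneg
  have hsq : (eLpNorm f 2 volume).toReal ^ 2 ≤ R ^ 2 := by
    rw [toReal_eLpNorm_sq_eq_scalarL2Sq hf, hR2]
    exact hle
  calc (eLpNorm f 2 volume).toReal = Real.sqrt ((eLpNorm f 2 volume).toReal ^ 2) :=
        (Real.sqrt_sq hn).symm
    _ ≤ Real.sqrt (R ^ 2) := Real.sqrt_le_sqrt hsq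
    _ = R := Real.sqrt_sq hR

end Summit.AnomalousDissipation.AnomalousDissipation.Theorems.RelaxationBoundsInventory.ELpNormDecay

end
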